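import Mathlib
import Summits.BirchSwinnertonDyer.BirchSwinnertonDyer.Theorems.ResidualThetaTransportAtTwoSignedMuSeedAtTwoPlusNonsquareDescentGrowthLinear
import Summits.BirchSwinnertonDyer.BirchSwinnertonDyer.Theorems.ResidualThetaTransportAtTwoSignedMuSeedAtTwoPlusNonsquareDescentGrowthInputs
import Summits.BirchSwinnertonDyer.BirchSwinnertonDyer.Theorems.ResidualThetaTransportAtTwoSignedMuSeedAtTwoPlusNonsquareDescentTorsionExponent
import HarnessLib

/-!
# Non-square descent — IWASAWA GROWTH AT `μ = 0`, COMPOSED: «`Q'/2Q'` torsion (the S3 (c) certificate) ⟹ `#(Q'/ω_nQ')` grows linearly in the exponent»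
# — seed crux `SignedMuSeedAtTwoPlus` stmt-BirchSwinnertonDyer-21438 (parent Kμ⁺ `SignedMuVanishingAtTwoPlus` stmt-BirchSwinnertonDyer-20689, route
# ResidualThetaTransportAtTwo), line card `Cruxes/SignedMuSeedAtTwoPlus/Lines/nonsquare-descent.md` (stubs S2/S3)

Cell `bsd-wall`, width seat `bsd-wall-rtt-p4-w2` g18 (`--supports`, closes nothing).  THEOREMS ONLY; BSD is not proved by this and
nothing arithmetic is asserted: composition of module algebra already in the tree.

The card's chain reads «`∃ m GNS(m)` ⟺ `μ(Q') = 0`» (S3, g17's certificate: «`Q'/2Q' = V_∞/⟨ū_∞⟩` is torsion ⟺ `∃ m ū_m ≠ 0`») and then uses `μ(Q') = 0`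
through the GROWTH of `#(Q'/ω_nQ')` (S2: «`μ(X^χ) ≤ μ(Q')`», i.e. `ord₂ #A(M_n)^χ ≤ ord₂ #(Q'/ω_nQ') + O(1)` is then linear in `n`).  This file closes
the module-theoretic loop: from «`Q'/pQ'` is a finitely generated TORSION `k⟦X⟧`-module» (`k` finite) — exactly the certificate's output — to
«`#(Q'/ω_nQ') = #(Q'/ω_{n₂}Q') · c^{n−n₂}` for `n ≥ n₂`» (`Theorems/…GrowthLinear.lean` + `…GrowthInputs.lean`), over any commutative `R` with
`(p) ⊆ Jac(R)` and `Q'` Noetherian, and over `Λ' = 𝒪⟦X⟧` with all ring-side hypotheses discharged.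

* `natCard_quotient_omega_eq_mul_pow_of_quotient_torsion` — abstract `R`, `φ : R → k⟦X⟧` with `φ T = X`, compatible structure on `M/pM`.
* `natCard_quotient_omega_eq_mul_pow_powerSeries` — `R = 𝒪⟦X⟧` (`𝒪` local, `p` a non-unit of `𝒪`), `T = X`, `φ = PowerSeries.map φ₀`.
* `exists_natCard_eq_prime_pow`, **`padicValNat_natCard_quotient_omega_linear`** — the `p`-adic reading: for `p` prime and finite quotients,
  `ord_p #(M/ω_nM) = d·(n − n₂) + b` for `n ≥ n₂` (LINEAR exponent, slope `λ' = d`).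

[folklore]
-/

set_option autoImplicit false
-- the Theorems namespace of this sub repeats the summit name by design (D-0017 nested layout)
set_option linter.dupNamespace false

open scoped Pointwise

namespace Summit.BirchSwinnertonDyer.BirchSwinnertonDyer.Theorems.SignedMuAtTwo.NonsquareDescent

/-- **«`Q'/pQ'` f.g. torsion over `k⟦X⟧` ⟹ linear growth of `#(Q'/ω_nQ')`» (abstract ring).**  `R` commutative with `(p) ⊆ Jac(R)`, `M` a Noetherian
`R`-module, `M/pM` carrying a `k⟦X⟧`-structure (`k` a finite field) compatible with `φ : R →+* k⟦X⟧`, `φ T = X`, finitely generated and TORSION over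
`k⟦X⟧`.  Then `∃ n₂ c, ∀ n ≥ n₂, #(M/ω_nM) = #(M/ω_{n₂}M)·c^{n−n₂}` with `ω_n = (1+T)^{pⁿ} − 1`. [folklore] -/
theorem natCard_quotient_omega_eq_mul_pow_of_quotient_torsion
    {R : Type*} [CommRing R] {M : Type*} [AddCommGroup M] [Module R M] [Module.Finite R M] [IsNoetherian R M]
    (p : ℕ) (hjac : Ideal.span {(p : R)} ≤ (⊥ : Ideal R).jacobson) (T : R)
    {k : Type*} [Field k] [Finite k]
    [Module (PowerSeries k) (M ⧸ ((p : R) • (⊤ : Submodule R M)))]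
    [Module.Finite (PowerSeries k) (M ⧸ ((p : R) • (⊤ : Submodule R M)))]
    (φ : R →+* PowerSeries k) (hcompat : ∀ (r : R) (w : M ⧸ ((p : R) • (⊤ : Submodule R M))), r • w = φ r • w)
    (hTX : φ T = PowerSeries.X)
    (htor : ∀ w : M ⧸ ((p : R) • (⊤ : Submodule R M)), ∃ b : PowerSeries k, b ≠ 0 ∧ b • w = 0) :
    ∃ (n₂ c : ℕ), ∀ n : ℕ, n₂ ≤ n →
      Nat.card (M ⧸ Ideal.span {(1 + T) ^ (p ^ n) - 1} • (⊤ : Submodule R M)) =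
        Nat.card (M ⧸ Ideal.span {(1 + T) ^ (p ^ n₂) - 1} • (⊤ : Submodule R M)) * c ^ (n - n₂) := by
  obtain ⟨N₀, hN₀⟩ := exists_X_pow_smul_eq_zero_of_torsion htor
  have hT : Ideal.span {T ^ N₀} • (⊤ : Submodule R M) ≤ Ideal.span {(p : R)} • ⊤ :=
    T_pow_smul_top_le_of_mkQ_torsion φ hcompat hTX hN₀
  obtain ⟨k', hk'⟩ := exists_uniform_pow_torsion_of_isNoetherian (M := M) (p : R)
  exact natCard_quotient_omega_eq_mul_pow p T hjac N₀ hT k' hk'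

/-- **The instance `Λ' = 𝒪⟦X⟧`.**  `𝒪` a local ring in which `p` is not a unit (so `(p) ⊆ Jac(𝒪⟦X⟧)`), `φ₀ : 𝒪 →+* k` onto a finite field (the
residue map), `M` (`= Q'`) a Noetherian `𝒪⟦X⟧`-module whose reduction `M/pM` carries a `k⟦X⟧`-structure compatible with `PowerSeries.map φ₀` and is f.g.
TORSION over `k⟦X⟧` («`μ(Q') = 0`», the S3 (c) certificate's output): then `#(M/ω_nM) = #(M/ω_{n₂}M)·c^{n−n₂}` for `n ≥ n₂`, `ω_n = (1+X)^{pⁿ} − 1` — LINEAR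
GROWTH of `ord #(Q'/ω_nQ')`, the «growth lemma» of stub S2 in kernel form. [folklore] -/
theorem natCard_quotient_omega_eq_mul_pow_powerSeries
    {A : Type*} [CommRing A] [IsLocalRing A] (p : ℕ) (hp : ¬ IsUnit (p : A))
    {M : Type*} [AddCommGroup M] [Module (PowerSeries A) M] [Module.Finite (PowerSeries A) M] [IsNoetherian (PowerSeries A) M]
    {k : Type*} [Field k] [Finite k] (φ₀ : A →+* k)
    [Module (PowerSeries k) (M ⧸ ((p : PowerSeries A) • (⊤ : Submodule (PowerSeries A) M)))]
    [Module.Finite (PowerSeries k) (M ⧸ ((p : PowerSeries A) • (⊤ : Submodule (PowerSeries A) M)))]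
    (hcompat : ∀ (r : PowerSeries A) (w : M ⧸ ((p : PowerSeries A) • (⊤ : Submodule (PowerSeries A) M))),
      r • w = PowerSeries.map φ₀ r • w)
    (htor : ∀ w : M ⧸ ((p : PowerSeries A) • (⊤ : Submodule (PowerSeries A) M)), ∃ b : PowerSeries k, b ≠ 0 ∧ b • w = 0) :
    ∃ (n₂ c : ℕ), ∀ n : ℕ, n₂ ≤ n →
      Nat.card (M ⧸ Ideal.span {((1 + PowerSeries.X : PowerSeries A)) ^ (p ^ n) - 1} • (⊤ : Submodule (PowerSeries A) M)) =
        Nat.card (M ⧸ Ideal.span {((1 + PowerSeries.X : PowerSeries A)) ^ (p ^ n₂) - 1} • (⊤ : Submodule (PowerSeries A) M)) *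
          c ^ (n - n₂) :=
  natCard_quotient_omega_eq_mul_pow_of_quotient_torsion p (natCast_span_le_jacobson_bot_powerSeries p hp) PowerSeries.X
    (PowerSeries.map φ₀) hcompat (PowerSeries.map_X φ₀) htor

/-! ## The `p`-adic reading: `ord_p #(M/ω_nM) = d·(n − n₂) + b` -/

section PAdic

variable {R : Type*} [CommRing R] {M : Type*} [AddCommGroup M] [Module R M]

/-- A FINITE module over a ring with `p ∈ Jac(R)` has `p`-power order: it is killed by a power of `p` (`…TorsionExponent`), hence is a `p`-group.
[folklore] -/
theorem exists_natCard_eq_prime_pow {F : Type*} [AddCommGroup F] [Module R F] [Finite F]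
    (p : ℕ) [Fact p.Prime] (hjac : Ideal.span {(p : R)} ≤ (⊥ : Ideal R).jacobson) :
    ∃ e : ℕ, Nat.card F = p ^ e := by
  obtain ⟨e, he⟩ := exists_pow_smul_eq_zero_of_mem_jacobson (B := F)
    ((Ideal.span_singleton_le_iff_mem _).mp hjac)
  have hP : IsPGroup p (Multiplicative F) := fun g => ⟨e, by
    rw [← ofAdd_toAdd g, ← ofAdd_nsmul, ← Nat.cast_smul_eq_nsmul R, Nat.cast_pow, he, ofAdd_zero]⟩
  obtain ⟨n, hn⟩ := (IsPGroup.iff_card).mp hP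
  exact ⟨n, by rw [← hn]; exact Nat.card_congr Multiplicative.ofAdd⟩

/-- **LINEAR GROWTH OF `ord_p #(M/ω_nM)` at `μ = 0`.**  Under the hypotheses of `natCard_quotient_omega_eq_mul_pow` (`(p) ⊆ Jac(R)`, `M` f.g.,
`T^{N₀}M ⊆ pM`, bounded `p`-power torsion), `p` prime, and FINITENESS of the quotients `M/ω_nM`: there are `n₂`, `d`, `b` with
`ord_p #(M/ω_nM) = d·(n − n₂) + b` for all `n ≥ n₂` — the exponent is eventually LINEAR (slope `d = λ'`, the shape consumed by
`Literature…classicalMuVanishes_of_classNumberPExp_le_linear`-type arguments). [folklore] -/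
theorem padicValNat_natCard_quotient_omega_linear [Module.Finite R M] (p : ℕ) [Fact p.Prime] (T : R)
    (hjac : Ideal.span {(p : R)} ≤ (⊥ : Ideal R).jacobson) (N₀ : ℕ)
    (hT : Ideal.span {T ^ N₀} • (⊤ : Submodule R M) ≤ Ideal.span {(p : R)} • ⊤)
    (k : ℕ) (htor : ∀ (x : M) (i : ℕ), ((p : R) ^ i) • x = 0 → ((p : R) ^ k) • x = 0)
    (hfin : ∀ n : ℕ, Finite (M ⧸ Ideal.span {(1 + T) ^ (p ^ n) - 1} • (⊤ : Submodule R M))) :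
    ∃ (n₂ d b : ℕ), ∀ n : ℕ, n₂ ≤ n →
      padicValNat p (Nat.card (M ⧸ Ideal.span {(1 + T) ^ (p ^ n) - 1} • (⊤ : Submodule R M))) = d * (n - n₂) + b := by
  obtain ⟨n₂, c, h⟩ := natCard_quotient_omega_eq_mul_pow p T hjac N₀ hT k htor
  haveI := hfin n₂
  haveI := hfin (n₂ + 1)
  obtain ⟨b, hb⟩ := exists_natCard_eq_prime_pow (F := M ⧸ Ideal.span {(1 + T) ^ (p ^ n₂) - 1} • (⊤ : Submodule R M)) p hjac
  obtain ⟨b', hb'⟩ :=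
    exists_natCard_eq_prime_pow (F := M ⧸ Ideal.span {(1 + T) ^ (p ^ (n₂ + 1)) - 1} • (⊤ : Submodule R M)) p hjac
  have hp : p.Prime := Fact.out
  -- `c` divides a power of `p`, so `c = p^d`
  have hc : c ∣ p ^ b' := by
    have h1 := h (n₂ + 1) (Nat.le_succ _)
    rw [hb', hb, Nat.add_sub_cancel_left, pow_one] at h1
    exact Dvd.intro_left _ h1.symm
  obtain ⟨d, -, rfl⟩ := (Nat.dvd_prime_pow hp).mp hc
  refine ⟨n₂, d, b, fun n hn => ?_⟩
  rw [h n hn, hb, ← pow_mul, ← pow_add, padicValNat.prime_pow, add_comm]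

end PAdic

end Summit.BirchSwinnertonDyer.BirchSwinnertonDyer.Theorems.SignedMuAtTwo.NonsquareDescent
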